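import Literature.MathematicalPhysics.QuantumFieldTheory.ShenZhuZhu2024YMHiggs
import Literature.MathematicalPhysics.QuantumFieldTheory.ConstructiveQFTWave0Proofs
import Literature.MathematicalPhysics.QuantumFieldTheory.StrongCouplingActivities
import HarnessLib

/-!
# Shen–Zhu–Zhu 2024, §5.3 Lemma (U-gauge fixing on the torus) — discharge of `szz24_uGauge_expectation`

H. Shen, R. Zhu, X. Zhu, *Langevin dynamics of lattice Yang–Mills–Higgs and applications*,
arXiv:2401.13299 [ShenZhuZhu2024Langevin], §5.3, Lemma "For any gauge invariant observable `h` on `𝒬`,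
it holds that `𝐄_{μ_Λ}(h) = 𝐄_{ν_Λ}(h(·, Id))`" (the U-gauge of E. Seiler, LNP 159 (1982)): the lattice
Yang–Mills–Higgs measure with Higgs field in `M = G = SO(N)` (left multiplication, Haar reference
measure, Hilbert–Schmidt kinetic term), integrated against a bounded measurable gauge-invariant
observable, equals the pure link measure `ν_Λ ∝ exp(Nβ Σ_p Tr Q_p + 2κN Σ_e Tr Q_e) Π_e dσ_N(Q_e)`
integrated against `h(·, Id)`.

Sibling proof file of `ShenZhuZhu2024YMHiggs.lean` (statements): the named fact
`Literature.MathematicalPhysics.QuantumFieldTheory.szz24_uGauge_expectation` is proved as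
`szz24_uGauge_expectation_holds`; no definition and no named fact is introduced.

## The printed proof and the proof here

The source (§5.3, following Driver's gauge-fixing set-up) disintegrates the Haar measure `m` of
`𝒬 = G^{E⁺} × G^{Λ}` along the gauge `v(Q, Φ) = Φ`: `∫_𝒬 f dm = ∫_{G^{E⁺}} dm₀(Q) ∫_{𝒢} dλ(g) f(g·Q, g·Id)`,
then uses the gauge invariance of `𝒮_YMH` and of `h` and `𝒮_YMH(Q, Id) = 𝒮'(Q)`.  On a finite torus the
disintegration is elementary and we prove it directly: by Fubini, `∫ f d(m₀ ⊗ λ) = ∫ dλ(Φ) ∫ dm₀(Q) f(Q, Φ)`,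
and for each fixed Higgs field `Φ` the link-by-link two-sided translation `Q ↦ Φ·Q`
(`(Φ·Q)_e = Φ_x Q_e Φ_y⁻¹`, the tree's `gaugeTransform Φ`) preserves the product Haar measure
(`WilsonGauge.measurePreserving_gaugeTransform`, unimodularity of compact groups), while
`(Φ·Q, Φ) = Φ·(Q, Id)`; so `∫ dm₀(Q) f(Q, Φ) = ∫ dm₀(Q) f(Φ·(Q, Id))`, which for the gauge-invariant
integrand `f = exp(𝒮_YMH)·h` is `∫ dm₀(Q) exp(𝒮_YMH(Q, Id)) h(Q, Id)`, independent of `Φ`.  Finally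
`𝒮_YMH(Q, Id) = 𝒮'(Q) − 2κN²·#E⁺` (`Tr((Q−I)(Q−I)ᵗ) = 2N − 2 Tr Q` for `Q ∈ SO(N)`; the source drops the
constant), and the constant cancels between numerator and partition function.

## References

* H. Shen, R. Zhu, X. Zhu, arXiv:2401.13299v2 (2024), §5.3: the gauge-fixed measure `ν_Λ`
  (e:gauge-fix-nu), the action `𝒮'_YMH`, and the Lemma `𝐄_{μ_Λ}(h) = 𝐄_{ν_Λ}(h(·, Id))` with its proof
  [ShenZhuZhu2024Langevin].
* E. Seiler, *Gauge Theories as a Problem of Constructive Quantum Field Theory and Statistical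
  Mechanics*, LNP 159 (1982) — U-gauge ("complete breakdown of symmetry").
* K. Wilson, Phys. Rev. D 10 (1974) 2445, §III.B — gauge invariance of the product Haar measure (tree:
  `WilsonGauge.measurePreserving_gaugeTransform`).
-/

noncomputable section

open MeasureTheory

namespace Literature.MathematicalPhysics.QuantumFieldTheory

namespace SZZ24UGauge

variable {d L N : ℕ}

/-! ## §1 Matrix algebra on `SO(N)`: conjugation invariance of the trace, invariance of the
Hilbert–Schmidt kinetic term, and its value at the identity Higgs field -/

/-- `gᵀ g = 1` for `g ∈ SO(N)`. [folklore] -/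
private theorem transpose_mul_self (g : Matrix.specialOrthogonalGroup (Fin N) ℝ) :
    (g : Matrix (Fin N) (Fin N) ℝ).transpose * (g : Matrix (Fin N) (Fin N) ℝ) = 1 := by
  have h := Matrix.mem_unitaryGroup_iff'.mp g.2.1
  rwa [Matrix.star_eq_conjTranspose, Matrix.conjTranspose_eq_transpose_of_trivial] at h

/-- `g gᵀ = 1` for `g ∈ SO(N)`. [folklore] -/
private theorem self_mul_transpose (g : Matrix.specialOrthogonalGroup (Fin N) ℝ) :
    (g : Matrix (Fin N) (Fin N) ℝ) * (g : Matrix (Fin N) (Fin N) ℝ).transpose = 1 := by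
  have h := Matrix.mem_unitaryGroup_iff.mp g.2.1
  rwa [Matrix.star_eq_conjTranspose, Matrix.conjTranspose_eq_transpose_of_trivial] at h

/-- The trace is invariant under conjugation in `SO(N)`: `Tr(g P g⁻¹) = Tr P`. [folklore] -/
private theorem trace_conj (g P : Matrix.specialOrthogonalGroup (Fin N) ℝ) :
    ((g * P * g⁻¹ : Matrix.specialOrthogonalGroup (Fin N) ℝ) : Matrix (Fin N) (Fin N) ℝ).trace =
      (P : Matrix (Fin N) (Fin N) ℝ).trace := by
  rw [Submonoid.coe_mul, Submonoid.coe_mul, Matrix.trace_mul_cycle, ← Submonoid.coe_mul, inv_mul_cancel,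
    Submonoid.coe_one, one_mul]

/-- The Hilbert–Schmidt kinetic term is invariant under a common left translation:
`Tr((gA − gB)(gA − gB)ᵗ) = Tr((A − B)(A − B)ᵗ)` for `g ∈ SO(N)`.
[cite: ShenZhuZhu2024Langevin, §2.1 (gauge invariance of 𝒮_YMH, case (3))] -/
theorem grpSqDist_mul_left (g A B : Matrix.specialOrthogonalGroup (Fin N) ℝ) :
    grpSqDist (g * A) (g * B) = grpSqDist A B := by
  unfold grpSqDist
  set D : Matrix (Fin N) (Fin N) ℝ := (A : Matrix (Fin N) (Fin N) ℝ) - B with hD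
  have h1 : ((g * A : Matrix.specialOrthogonalGroup (Fin N) ℝ) : Matrix (Fin N) (Fin N) ℝ) -
      (g * B : Matrix.specialOrthogonalGroup (Fin N) ℝ) = (g : Matrix (Fin N) (Fin N) ℝ) * D := by
    rw [Submonoid.coe_mul, Submonoid.coe_mul, hD, Matrix.mul_sub]
  rw [h1, Matrix.transpose_mul, ← Matrix.mul_assoc, Matrix.trace_mul_cycle, ← Matrix.mul_assoc,
    transpose_mul_self, Matrix.one_mul]

/-- The kinetic term at the identity Higgs field: `Tr((Q − I)(Q − I)ᵗ) = 2N − 2 Tr Q` for `Q ∈ SO(N)`.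
[cite: ShenZhuZhu2024Langevin, §5.3 (𝒮_YMH(Q, Id) = 𝒮'_YMH(Q))] -/
theorem grpSqDist_one_right (Q : Matrix.specialOrthogonalGroup (Fin N) ℝ) :
    grpSqDist Q 1 = 2 * N - 2 * (Q : Matrix (Fin N) (Fin N) ℝ).trace := by
  unfold grpSqDist
  rw [Submonoid.coe_one, Matrix.transpose_sub, Matrix.transpose_one, Matrix.sub_mul, Matrix.mul_sub,
    Matrix.mul_sub, self_mul_transpose, Matrix.mul_one, Matrix.one_mul, Matrix.one_mul,
    Matrix.trace_sub, Matrix.trace_sub, Matrix.trace_sub, Matrix.trace_one, Matrix.trace_transpose,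
    Fintype.card_fin]
  ring

/-! ## §2 Gauge invariance of the YMH action (case `M = G`) and its value at `Φ ≡ Id` -/

/-- The plaquette holonomy of a gauge-transformed configuration is the conjugate of the holonomy:
`(Q^g)_p = g_x Q_p g_x⁻¹` for the plaquette at `x`. [folklore] -/
private theorem plaquetteHolonomy_gaugeTransform {G : Type*} [Group G] (g : Site d L → G)
    (U : GaugeConfig d L G) (x : Site d L) (i j : Fin d) :
    plaquetteHolonomy (gaugeTransform g U) x i j = g x * plaquetteHolonomy U x i j * (g x)⁻¹ := by
  have hshift : (x.shift i).shift j = (x.shift j).shift i := by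
    simp only [Site.shift, add_assoc, add_comm (Pi.single (M := fun _ => ZMod L) i 1)]
  simp only [plaquetteHolonomy, gaugeTransform, hshift, mul_inv_rev, inv_inv]
  group

/-- **Gauge invariance of `𝒮_YMH`, case (3) `M = G`** (left multiplication, Hilbert–Schmidt kinetic
term, no mass term): `𝒮_YMH(g·(Q, Φ)) = 𝒮_YMH(Q, Φ)` — the plaquette traces are conjugation invariant and
`|g_x Q_e g_y⁻¹ · g_y Φ_y − g_x Φ_x|² = |Q_e Φ_y − Φ_x|²`.
[cite: ShenZhuZhu2024Langevin, §2.1 (gauge invariance of 𝒮_YMH) and §5.3 (third step of the proof of the Lemma)] -/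
theorem ymhAction_grp_gaugeTransform [NeZero L] (β κ : ℝ)
    (g : Site d L → Matrix.specialOrthogonalGroup (Fin N) ℝ)
    (c : GaugeConfig d L (Matrix.specialOrthogonalGroup (Fin N) ℝ) ×
      (Site d L → Matrix.specialOrthogonalGroup (Fin N) ℝ)) :
    ymhAction (d := d) (L := L) grpAct grpSqDist (fun _ => (0 : ℝ)) β κ 0 (grpGaugeTransformTorus g c) =
      ymhAction (d := d) (L := L) grpAct grpSqDist (fun _ => (0 : ℝ)) β κ 0 c := by
  unfold ymhAction grpGaugeTransformTorus
  have hp : ∀ p : Plaquette d L,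
      ((plaquetteHolonomy (gaugeTransform g c.1) p.1 p.2.1.1 p.2.1.2 :
          Matrix.specialOrthogonalGroup (Fin N) ℝ) : Matrix (Fin N) (Fin N) ℝ).trace =
        ((plaquetteHolonomy c.1 p.1 p.2.1.1 p.2.1.2 : Matrix.specialOrthogonalGroup (Fin N) ℝ) :
          Matrix (Fin N) (Fin N) ℝ).trace := fun p => by
    rw [plaquetteHolonomy_gaugeTransform, trace_conj]
  have he : ∀ e : Edge d L,
      grpSqDist (grpAct (gaugeTransform g c.1 e) (g (e.1.shift e.2) * c.2 (e.1.shift e.2))) (g e.1 * c.2 e.1) =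
        grpSqDist (grpAct (c.1 e) (c.2 (e.1.shift e.2))) (c.2 e.1) := fun e => by
    have h1 : grpAct (gaugeTransform g c.1 e) (g (e.1.shift e.2) * c.2 (e.1.shift e.2)) =
        g e.1 * grpAct (c.1 e) (c.2 (e.1.shift e.2)) := by
      simp only [grpAct, gaugeTransform, mul_assoc, inv_mul_cancel_left]
    rw [h1, grpSqDist_mul_left]
  simp only [hp, he]

/-- **`𝒮_YMH(Q, Id) = 𝒮'(Q) − 2κN²·#E⁺`**: at the identity Higgs field the YMH action of case (3) is the
gauge-fixed action `uGaugeAction` up to the additive constant `2κN²·#E⁺_Λ` (the source absorbs it in the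
normalisation). [cite: ShenZhuZhu2024Langevin, §5.3 (𝒮_YMH(Q, Id) = 𝒮'_YMH(Q), definition of 𝒮'_YMH)] -/
theorem ymhAction_grp_one [NeZero L] (β κ : ℝ)
    (U : GaugeConfig d L (Matrix.specialOrthogonalGroup (Fin N) ℝ)) :
    ymhAction (d := d) (L := L) grpAct grpSqDist (fun _ => (0 : ℝ)) β κ 0
        (U, fun _ => (1 : Matrix.specialOrthogonalGroup (Fin N) ℝ)) =
      uGaugeAction (d := d) (L := L) (N := N) β κ U - 2 * κ * N ^ 2 * Fintype.card (Edge d L) := by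
  unfold ymhAction uGaugeAction
  have he : ∀ e : Edge d L, grpSqDist (grpAct (U e) 1) 1 =
      2 * N - 2 * ((U e : Matrix.specialOrthogonalGroup (Fin N) ℝ) : Matrix (Fin N) (Fin N) ℝ).trace :=
    fun e => by rw [grpAct, mul_one, grpSqDist_one_right]
  simp only [he, Finset.sum_sub_distrib, Finset.sum_const, Finset.card_univ, nsmul_eq_mul,
    ← Finset.mul_sum, mul_zero, sub_zero]
  ring

/-! ## §3 Continuity (hence measurability and boundedness) of the two actions -/

/-- The plaquette holonomy depends continuously on the configuration. [folklore] -/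
private theorem continuous_plaquetteHolonomy {G : Type*} [Group G] [TopologicalSpace G]
    [IsTopologicalGroup G] (x : Site d L) (i j : Fin d) :
    Continuous fun U : GaugeConfig d L G => plaquetteHolonomy U x i j := by
  unfold plaquetteHolonomy
  fun_prop

/-- The Hilbert–Schmidt kinetic term is (jointly) continuous. [folklore] -/
private theorem continuous_grpSqDist {X : Type*} [TopologicalSpace X]
    {A B : X → Matrix.specialOrthogonalGroup (Fin N) ℝ} (hA : Continuous A) (hB : Continuous B) :
    Continuous fun x => grpSqDist (A x) (B x) := by
  unfold grpSqDist
  have h1 : Continuous fun x => ((A x : Matrix.specialOrthogonalGroup (Fin N) ℝ) : Matrix (Fin N) (Fin N) ℝ) - B x :=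
    (continuous_subtype_val.comp hA).sub (continuous_subtype_val.comp hB)
  exact (h1.mul h1.matrix_transpose).matrix_trace

/-- The YMH action of case (3) is continuous on the (compact) torus configuration space. [folklore] -/
private theorem continuous_ymhAction_grp [NeZero L] (β κ : ℝ) :
    Continuous fun c : GaugeConfig d L (Matrix.specialOrthogonalGroup (Fin N) ℝ) ×
        (Site d L → Matrix.specialOrthogonalGroup (Fin N) ℝ) =>
      ymhAction (d := d) (L := L) grpAct grpSqDist (fun _ => (0 : ℝ)) β κ 0 c := by
  unfold ymhAction
  refine ((continuous_const.mul (continuous_finsetSum _ fun p _ => ?_)).sub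
    (continuous_const.mul (continuous_finsetSum _ fun e _ => ?_))).sub continuous_const
  · exact (continuous_subtype_val.comp ((continuous_plaquetteHolonomy p.1 p.2.1.1 p.2.1.2).comp
      continuous_fst)).matrix_trace
  · have hA : Continuous fun c : GaugeConfig d L (Matrix.specialOrthogonalGroup (Fin N) ℝ) ×
        (Site d L → Matrix.specialOrthogonalGroup (Fin N) ℝ) => grpAct (c.1 e) (c.2 (e.1.shift e.2)) := by
      simp only [grpAct]
      exact ((continuous_apply e).comp continuous_fst).mul ((continuous_apply _).comp continuous_snd)
    exact continuous_grpSqDist hA ((continuous_apply _).comp continuous_snd)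

/-- The gauge-fixed action `𝒮'` is continuous. [folklore] -/
private theorem continuous_uGaugeAction [NeZero L] (β κ : ℝ) :
    Continuous fun U : GaugeConfig d L (Matrix.specialOrthogonalGroup (Fin N) ℝ) =>
      uGaugeAction (d := d) (L := L) (N := N) β κ U := by
  unfold uGaugeAction
  refine (continuous_const.mul (continuous_finsetSum _ fun p _ => ?_)).add
    (continuous_const.mul (continuous_finsetSum _ fun e _ => ?_))
  · exact (continuous_subtype_val.comp (continuous_plaquetteHolonomy p.1 p.2.1.1 p.2.1.2)).matrix_trace
  · exact (continuous_subtype_val.comp (continuous_apply e)).matrix_trace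

/-! ## §4 Integration against a normalised exponential weight -/

/-- For a continuous real `S` on a compact space with a finite measure `μ` and a bounded measurable `h`:
`∫ h d((μ.withDensity e^S)(univ)⁻¹ • μ.withDensity e^S) = (∫ e^S dμ)⁻¹ · ∫ e^S h dμ`. [folklore] -/
private theorem integral_normalised_expWeight {X : Type*} [MeasurableSpace X] [TopologicalSpace X]
    [CompactSpace X] [OpensMeasurableSpace X] (μ : Measure X) [IsFiniteMeasure μ]
    {S : X → ℝ} (hS : Continuous S) (h : X → ℝ) :
    ∫ x, h x ∂((μ.withDensity (fun x => ENNReal.ofReal (Real.exp (S x))) Set.univ)⁻¹ •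
        μ.withDensity fun x => ENNReal.ofReal (Real.exp (S x))) =
      (∫ x, Real.exp (S x) ∂μ)⁻¹ * ∫ x, Real.exp (S x) * h x ∂μ := by
  have hSm : Measurable fun x => ENNReal.ofReal (Real.exp (S x)) :=
    ENNReal.measurable_ofReal.comp (Real.measurable_exp.comp hS.measurable)
  have hexp_cont : Continuous fun x => Real.exp (S x) := Real.continuous_exp.comp hS
  obtain ⟨B, hB⟩ : ∃ B, ∀ x, Real.exp (S x) ≤ B := by
    rcases isEmpty_or_nonempty X with hX | hX
    · exact ⟨0, fun x => (IsEmpty.false x).elim⟩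
    · obtain ⟨x₀, -, hx₀⟩ := isCompact_univ.exists_isMaxOn Set.univ_nonempty hexp_cont.continuousOn
      exact ⟨Real.exp (S x₀), fun x => hx₀ (Set.mem_univ x)⟩
  have hint : Integrable (fun x => Real.exp (S x)) μ := by
    refine Integrable.of_bound (hexp_cont.measurable.aestronglyMeasurable) B (ae_of_all _ fun x => ?_)
    rw [Real.norm_eq_abs, abs_of_pos (Real.exp_pos _)]
    exact hB x
  rw [integral_smul_measure, integral_withDensity_eq_integral_toReal_smul hSm
    (ae_of_all _ fun x => ENNReal.ofReal_lt_top), withDensity_apply _ MeasurableSet.univ,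
    Measure.restrict_univ, ← ofReal_integral_eq_lintegral_ofReal hint (ae_of_all _ fun x => (Real.exp_pos _).le),
    ENNReal.toReal_inv, ENNReal.toReal_ofReal (integral_nonneg fun x => (Real.exp_pos _).le), smul_eq_mul]
  congr 1
  refine integral_congr_ae (ae_of_all _ fun x => ?_)
  simp only [ENNReal.toReal_ofReal (Real.exp_pos _).le, smul_eq_mul]

/-! ## §5 The disintegration along the U-gauge on the torus -/

/-- **The change of variables `(Q, Φ) = Φ·(Q', Id)`**: for every Higgs field `Φ : Λ → SO(N)` and every
integrand `F` on link configurations, `∫ F(Q) Π dσ_N(Q_e) = ∫ F(Φ·Q) Π dσ_N(Q_e)` — the product Haar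
measure is invariant under gauge transformations (unimodularity).
[cite: ShenZhuZhu2024Langevin, §5.3 (disintegration formula (e:mv), m_v = push-forward of Haar measure)] -/
theorem integral_pi_haar_gaugeTransform [NeZero L] (Φ : Site d L → Matrix.specialOrthogonalGroup (Fin N) ℝ)
    (F : GaugeConfig d L (Matrix.specialOrthogonalGroup (Fin N) ℝ) → ℝ) :
    ∫ Q, F (gaugeTransform Φ Q) ∂(Measure.pi fun _ : Edge d L =>
        haarProbability (Matrix.specialOrthogonalGroup (Fin N) ℝ)) =
      ∫ Q, F Q ∂(Measure.pi fun _ : Edge d L => haarProbability (Matrix.specialOrthogonalGroup (Fin N) ℝ)) := by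
  let e : GaugeConfig d L (Matrix.specialOrthogonalGroup (Fin N) ℝ) ≃ᵐ
      GaugeConfig d L (Matrix.specialOrthogonalGroup (Fin N) ℝ) :=
    { toFun := gaugeTransform Φ
      invFun := gaugeTransform Φ⁻¹
      left_inv := fun U => funext fun e => by simp [gaugeTransform, mul_assoc]
      right_inv := fun U => funext fun e => by simp [gaugeTransform, mul_assoc]
      measurable_toFun := (WilsonGauge.measurePreserving_gaugeTransform Φ).measurable
      measurable_invFun := (WilsonGauge.measurePreserving_gaugeTransform Φ⁻¹).measurable }
  have he : MeasurePreserving e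
      (Measure.pi fun _ : Edge d L => haarProbability (Matrix.specialOrthogonalGroup (Fin N) ℝ))
      (Measure.pi fun _ : Edge d L => haarProbability (Matrix.specialOrthogonalGroup (Fin N) ℝ)) :=
    WilsonGauge.measurePreserving_gaugeTransform Φ
  exact he.integral_comp' F

/-- **The U-gauge disintegration of a gauge-invariant integrand on the torus** (the measure-theoretic
core of the §5.3 Lemma): for a bounded measurable `F` on `𝒬 = G^{E⁺} × G^{Λ}` invariant under all gauge
transformations `g·(Q, Φ) = (g·Q, g·Φ)`,
`∫ F d(Π_e σ_N ⊗ Π_x σ_N) = ∫ F(Q, Id) Π_e dσ_N(Q_e)`.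
[cite: ShenZhuZhu2024Langevin, §5.3 (proof of the Lemma, steps 2-3: (e:mv) and gauge invariance)] -/
theorem integral_prod_eq_integral_uGauge [NeZero L]
    (F : GaugeConfig d L (Matrix.specialOrthogonalGroup (Fin N) ℝ) ×
      (Site d L → Matrix.specialOrthogonalGroup (Fin N) ℝ) → ℝ)
    (hFm : Measurable F) (C : ℝ) (hC : ∀ c, |F c| ≤ C)
    (hFg : ∀ g c, F (grpGaugeTransformTorus g c) = F c) :
    ∫ c, F c ∂((Measure.pi fun _ : Edge d L => haarProbability (Matrix.specialOrthogonalGroup (Fin N) ℝ)).prod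
        (Measure.pi fun _ : Site d L => haarProbability (Matrix.specialOrthogonalGroup (Fin N) ℝ))) =
      ∫ Q, F (Q, fun _ => 1) ∂(Measure.pi fun _ : Edge d L =>
        haarProbability (Matrix.specialOrthogonalGroup (Fin N) ℝ)) := by
  set P : Measure (GaugeConfig d L (Matrix.specialOrthogonalGroup (Fin N) ℝ)) :=
    Measure.pi fun _ : Edge d L => haarProbability (Matrix.specialOrthogonalGroup (Fin N) ℝ) with hP
  set R : Measure (Site d L → Matrix.specialOrthogonalGroup (Fin N) ℝ) :=
    Measure.pi fun _ : Site d L => haarProbability (Matrix.specialOrthogonalGroup (Fin N) ℝ) with hR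
  have hint : Integrable F (P.prod R) :=
    Integrable.of_bound hFm.aestronglyMeasurable C (ae_of_all _ fun c => by
      rw [Real.norm_eq_abs]; exact hC c)
  rw [integral_prod_symm F hint]
  have hinner : ∀ Φ : Site d L → Matrix.specialOrthogonalGroup (Fin N) ℝ,
      ∫ Q, F (Q, Φ) ∂P = ∫ Q, F (Q, fun _ => 1) ∂P := fun Φ => by
    rw [← integral_pi_haar_gaugeTransform Φ (fun Q => F (Q, Φ))]
    refine integral_congr_ae (ae_of_all _ fun Q => ?_)
    have h1 : (gaugeTransform Φ Q, Φ) =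
        grpGaugeTransformTorus Φ (Q, fun _ => (1 : Matrix.specialOrthogonalGroup (Fin N) ℝ)) := by
      simp only [grpGaugeTransformTorus, mul_one]
    simp only [h1, hFg]
  haveI : IsProbabilityMeasure R := by
    rw [hR]; exact Measure.pi.instIsProbabilityMeasure _
  simp only [hinner, integral_const, probReal_univ, one_smul]

end SZZ24UGauge

/-! ## §6 The theorem -/

open SZZ24UGauge in
/-- **Shen–Zhu–Zhu 2024, §5.3 Lemma (U-gauge fixing on the torus), `M = G = SO(N)` — the named fact
`szz24_uGauge_expectation` PROVED.** For every torus `(ℤ/L)^d`, every `N` (the fact asks `N ≥ 3`, the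
paper's standing assumption; the identity holds for all `N`), all real `β, κ` and every bounded measurable
gauge-invariant `h` on `𝒬 = G^{E⁺} × G^{Λ}`:
`∫ h dμ_Λ = ∫ h(Q, Id) dν_Λ(Q)`, `μ_Λ` the YMH measure of case (3) (Haar reference measure, left
multiplication, Hilbert–Schmidt kinetic term, no mass term) and `ν_Λ ∝ exp(Nβ Σ_p Tr Q_p + 2κN Σ_e Tr Q_e) Π dσ_N`.
Proof: Fubini and the gauge invariance of the product Haar measure give
`∫ e^{𝒮} h d(m₀ ⊗ λ) = ∫ e^{𝒮(Q,Id)} h(Q,Id) dm₀(Q)` (`integral_prod_eq_integral_uGauge`, gauge invariance of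
`𝒮_YMH` and `h`); `𝒮_YMH(Q, Id) = 𝒮'(Q) − 2κN²·#E⁺` (`ymhAction_grp_one`) and the constant cancels against
the partition function. [cite: ShenZhuZhu2024Langevin, §5.3 Lemma (𝐄_{μ_Λ}(h) = 𝐄_{ν_Λ}(h(·, Id)))] -/
theorem szz24_uGauge_expectation_holds : szz24_uGauge_expectation := by
  intro d L N _ _ β κ h hhm hhb hhg
  obtain ⟨C, hC⟩ := hhb
  -- the two configuration spaces and their a priori (product Haar) measures
  set P : Measure (GaugeConfig d L (Matrix.specialOrthogonalGroup (Fin N) ℝ)) :=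
    Measure.pi fun _ : Edge d L => haarProbability (Matrix.specialOrthogonalGroup (Fin N) ℝ) with hP
  set R : Measure (Site d L → Matrix.specialOrthogonalGroup (Fin N) ℝ) :=
    Measure.pi fun _ : Site d L => haarProbability (Matrix.specialOrthogonalGroup (Fin N) ℝ) with hR
  set S : GaugeConfig d L (Matrix.specialOrthogonalGroup (Fin N) ℝ) ×
      (Site d L → Matrix.specialOrthogonalGroup (Fin N) ℝ) → ℝ :=
    fun c => ymhAction (d := d) (L := L) grpAct grpSqDist (fun _ => (0 : ℝ)) β κ 0 c with hS
  set S' : GaugeConfig d L (Matrix.specialOrthogonalGroup (Fin N) ℝ) → ℝ :=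
    fun U => uGaugeAction (d := d) (L := L) (N := N) β κ U with hS'
  set K : ℝ := 2 * κ * N ^ 2 * Fintype.card (Edge d L) with hK
  have hSc : Continuous S := continuous_ymhAction_grp β κ
  have hS'c : Continuous S' := continuous_uGaugeAction β κ
  -- unfold the two normalised Gibbs measures
  have hL : ∫ c, h c ∂(ymhMeasure (d := d) (L := L)
      (haarProbability (Matrix.specialOrthogonalGroup (Fin N) ℝ)) grpAct grpSqDist (fun _ => 0) β κ 0) =
      (∫ c, Real.exp (S c) ∂(P.prod R))⁻¹ * ∫ c, Real.exp (S c) * h c ∂(P.prod R) :=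
    integral_normalised_expWeight (P.prod R) hSc h
  have hRt : ∫ U, h (U, fun _ => 1) ∂(uGaugeMeasure (d := d) (L := L) (N := N) β κ) =
      (∫ U, Real.exp (S' U) ∂P)⁻¹ * ∫ U, Real.exp (S' U) * h (U, fun _ => 1) ∂P :=
    integral_normalised_expWeight P hS'c _
  rw [hL, hRt]
  -- `exp 𝒮` is bounded on the compact configuration space
  obtain ⟨B, hB⟩ : ∃ B, ∀ c, Real.exp (S c) ≤ B := by
    obtain ⟨c₀, -, hc₀⟩ := isCompact_univ.exists_isMaxOn Set.univ_nonempty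
      (Real.continuous_exp.comp hSc).continuousOn
    exact ⟨Real.exp (S c₀), fun c => hc₀ (Set.mem_univ c)⟩
  have hB0 : 0 ≤ B := (Real.exp_pos _).le.trans (hB (fun _ => 1, fun _ => 1))
  -- the disintegration applied to `exp 𝒮 · h` and to `exp 𝒮`
  have hnum : ∫ c, Real.exp (S c) * h c ∂(P.prod R) = Real.exp (-K) * ∫ U, Real.exp (S' U) * h (U, fun _ => 1) ∂P := by
    rw [integral_prod_eq_integral_uGauge (fun c => Real.exp (S c) * h c)
      ((Real.measurable_exp.comp hSc.measurable).mul hhm) (B * C) (fun c => ?_) (fun g c => ?_),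
      ← integral_const_mul]
    · refine integral_congr_ae (ae_of_all _ fun U => ?_)
      simp only [hS, ymhAction_grp_one, hK, Real.exp_sub, div_eq_mul_inv, Real.exp_neg]
      ring
    · rw [abs_mul, abs_of_pos (Real.exp_pos _)]
      exact mul_le_mul (hB c) (hC c) (abs_nonneg _) hB0
    · simp only [hS, ymhAction_grp_gaugeTransform, hhg]
  have hden : ∫ c, Real.exp (S c) ∂(P.prod R) = Real.exp (-K) * ∫ U, Real.exp (S' U) ∂P := by
    rw [integral_prod_eq_integral_uGauge (fun c => Real.exp (S c)) (Real.measurable_exp.comp hSc.measurable)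
      B (fun c => ?_) (fun g c => ?_), ← integral_const_mul]
    · refine integral_congr_ae (ae_of_all _ fun U => ?_)
      simp only [hS, ymhAction_grp_one, hK, Real.exp_sub, div_eq_mul_inv, Real.exp_neg]
      ring
    · rw [abs_of_pos (Real.exp_pos _)]
      exact hB c
    · simp only [hS, ymhAction_grp_gaugeTransform]
  rw [hnum, hden, mul_inv, mul_mul_mul_comm, inv_mul_cancel₀ (Real.exp_pos _).ne', one_mul]

end Literature.MathematicalPhysics.QuantumFieldTheory

end
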